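import Literature.Barriers.CriticalPhenomena.FKParafermionicHalfCauchyRiemann
import HarnessLib

/-!
# The `ψ`-weighted discrete Green identity of the half-Cauchy–Riemann edge form
# (glue for line `iic-trace-flux-pairing`, stub S5 `stub_touchLawOfPairing`, step (i))

Crux `ParafermionToSLESixFamilies` (stmt-CriticalPhenomena-11389), line `iic-trace-flux-pairing`
(checked skeleton `Cruxes/ParafermionToSLESixFamilies/Lines/iic_trace_flux_pairing.lean`). Step (i) of
the engine S5 pairs the vertex relations of the spin-`1/3` corner observable (Duminil-Copin 2012,
Prop. 4; support item stmt-11306 `HalfCRVertexRelation`) against a TEST FUNCTION `ψ` on medial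
vertices. The barrier file `Literature/Barriers/CriticalPhenomena/FKParafermionicHalfCauchyRiemann.lean`
proves the unweighted identity `sum_halfCRForm_eq_halfCRFlux` (`ψ ≡ 1`: interior medial edges cancel,
the boundary flux remains). Here the EXACT weighted form, for every coefficient `c`, every finite set
`S` of medial vertices, every weight `ψ` and every edge function `F` (no relation assumed):

`∑_{p ∈ S} ψ_p · halfCRForm c p F`
`  = ½ ∑_{p ∈ S, k : twin ∈ S} coeff c k · F(e_{p,k}) · (ψ_p − ψ_twin) + ∑_{p ∈ S, k : twin ∉ S} ψ_p · coeff c k · F(e_{p,k})`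

(`sum_weighted_halfCRForm_eq`, registered glue): an interior medial edge no longer cancels between its
two medial vertices `p` and `twin p k` (where it is the antipodal corner with the opposite coefficient,
`HalfCRGreen.coeff_add_two`, `HalfCRGreen.medialCornersAt_twin`) but leaves the DISCRETE DERIVATIVE
`ψ_p − ψ_twin` of the weight — the lattice `∂̄ψ`-pairing of step (i) — while the medial edges leaving
`S` give the `ψ`-weighted boundary flux. Corollaries: `ψ ≡ 1` is the barrier identity
(`sum_weighted_halfCRForm_one`); if `F` obeys the relation at every vertex of `S`, the interior pairing
equals minus the weighted flux (`weighted_pairing_eq_neg_flux_of_rel`) — the form in which S5 bounds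
the boundary trace by interior data. Pure finite algebra over the barrier file's certified tables.
-/

noncomputable section

open scoped BigOperators
open Literature.Probability.LatticeModels
open Literature.Barriers.CriticalPhenomena
open Literature.Barriers.CriticalPhenomena.HalfCRGreen

namespace Summit.CriticalPhenomena.CardyFormulaZ2.Cruxes.ParafermionToSLESixFamilies.IicTraceFluxPairing

/-- The corner-indexed summand `ψ_p · coeff c k · F(e_{p,k})` summed over the INTERIOR corners of `S`
(those whose twin medial vertex lies in `S`) equals minus the same sum with `ψ` read at the twin:
reindex by the involution `(p, k) ↦ (twin p k, k + 2)` of the interior corners, under which the medial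
edge is unchanged and the coefficient changes sign. -/
theorem sum_interior_weight_eq_neg_sum_twin_weight (c : ℂ) (S : Finset (Site 2 × Fin 2))
    (ψ : Site 2 × Fin 2 → ℂ) (F : Site 2 × Site 2 → ℂ) :
    (∑ p ∈ S, ∑ k : Fin 4, if twin p.1 p.2 k ∈ S then
        ψ p * (coeff c k * F (medialCornersAt p.1 p.2 k)) else 0) =
      -∑ p ∈ S, ∑ k : Fin 4, if twin p.1 p.2 k ∈ S then
        ψ (twin p.1 p.2 k) * (coeff c k * F (medialCornersAt p.1 p.2 k)) else 0 := by
  classical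
  -- both sides as sums over the finite set `T` of interior corners
  set T := (S ×ˢ (Finset.univ : Finset (Fin 4))).filter (fun a => twin a.1.1 a.1.2 a.2 ∈ S) with hT
  have hL : (∑ p ∈ S, ∑ k : Fin 4, if twin p.1 p.2 k ∈ S then
      ψ p * (coeff c k * F (medialCornersAt p.1 p.2 k)) else 0) =
      ∑ a ∈ T, ψ a.1 * (coeff c a.2 * F (medialCornersAt a.1.1 a.1.2 a.2)) := by
    rw [hT, Finset.sum_filter, Finset.sum_product]
  have hR : (∑ p ∈ S, ∑ k : Fin 4, if twin p.1 p.2 k ∈ S then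
      ψ (twin p.1 p.2 k) * (coeff c k * F (medialCornersAt p.1 p.2 k)) else 0) =
      ∑ a ∈ T, ψ (twin a.1.1 a.1.2 a.2) * (coeff c a.2 * F (medialCornersAt a.1.1 a.1.2 a.2)) := by
    rw [hT, Finset.sum_filter, Finset.sum_product]
  rw [hL, hR, ← Finset.sum_neg_distrib]
  -- reindex the left sum by the involution `σ (p, k) = (twin p k, k + 2)`
  have hmem : ∀ a ∈ T, ((twin a.1.1 a.1.2 a.2, a.2 + 2) : (Site 2 × Fin 2) × Fin 4) ∈ T := by
    rintro ⟨⟨x, i⟩, k⟩ ha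
    simp only [hT, Finset.mem_filter, Finset.mem_product, Finset.mem_univ, and_true] at ha ⊢
    rw [twin_twin]
    exact ⟨ha.2, ha.1⟩
  have hinv : ∀ a ∈ T, ((twin (twin a.1.1 a.1.2 a.2).1 (twin a.1.1 a.1.2 a.2).2 (a.2 + 2),
      a.2 + 2 + 2) : (Site 2 × Fin 2) × Fin 4) = a := by
    rintro ⟨⟨x, i⟩, k⟩ _
    refine Prod.ext (twin_twin x i k) ?_
    show k + 2 + 2 = k
    fin_cases k <;> rfl
  refine Finset.sum_nbij' (fun a => (twin a.1.1 a.1.2 a.2, a.2 + 2))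
    (fun a => (twin a.1.1 a.1.2 a.2, a.2 + 2)) hmem hmem hinv hinv ?_
  rintro ⟨⟨x, i⟩, k⟩ _
  simp only [medialCornersAt_twin, coeff_add_two, twin_twin]
  ring

/-- **Registered glue `sum_weighted_halfCRForm_eq` — the `ψ`-weighted discrete Green identity** of the
half-Cauchy–Riemann edge form (step (i) of S5 `stub_touchLawOfPairing`; generalises the barrier file's
`sum_halfCRForm_eq_halfCRFlux`, which is `ψ ≡ 1`). For every coefficient `c`, finite set `S` of medial
vertices, weight `ψ` on medial vertices and function `F` on medial edges:
`∑_{p ∈ S} ψ_p · halfCRForm c p F = ½ ∑_{(p,k) interior} coeff c k · F(e_{p,k}) · (ψ_p − ψ_{twin p k})`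
`+ ∑_{(p,k) boundary} ψ_p · coeff c k · F(e_{p,k})`, "interior" meaning `twin p k ∈ S`. Exact; no
relation on `F` is assumed. -/
theorem sum_weighted_halfCRForm_eq : ∀ (c : ℂ) (S : Finset (Site 2 × Fin 2)) (ψ : Site 2 × Fin 2 → ℂ) (F : Site 2 × Site 2 → ℂ), ∑ p ∈ S, ψ p * halfCRForm c p F = (1 / 2 : ℂ) * (∑ p ∈ S, ∑ k : Fin 4, if HalfCRGreen.twin p.1 p.2 k ∈ S then HalfCRGreen.coeff c k * F (medialCornersAt p.1 p.2 k) * (ψ p - ψ (HalfCRGreen.twin p.1 p.2 k)) else 0) + ∑ p ∈ S, ∑ k : Fin 4, if HalfCRGreen.twin p.1 p.2 k ∈ S then 0 else ψ p * (HalfCRGreen.coeff c k * F (medialCornersAt p.1 p.2 k)) := by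
  intro c S ψ F
  classical
  -- split every weighted relation into its interior and boundary corners
  have hsplit : ∀ p ∈ S, ψ p * halfCRForm c p F =
      (∑ k : Fin 4, if twin p.1 p.2 k ∈ S then ψ p * (coeff c k * F (medialCornersAt p.1 p.2 k)) else 0) +
        ∑ k : Fin 4, if twin p.1 p.2 k ∈ S then 0 else ψ p * (coeff c k * F (medialCornersAt p.1 p.2 k)) := by
    intro p _
    rw [halfCRForm_eq_sum, Finset.mul_sum, ← Finset.sum_add_distrib]
    refine Finset.sum_congr rfl fun k _ => ?_
    split_ifs <;> simp
  rw [Finset.sum_congr rfl hsplit, Finset.sum_add_distrib]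
  congr 1
  -- the interior part: average the sum with its reindexed (negated, twin-weighted) copy
  set I := ∑ p ∈ S, ∑ k : Fin 4, if twin p.1 p.2 k ∈ S then
      ψ p * (coeff c k * F (medialCornersAt p.1 p.2 k)) else 0 with hI
  set J := ∑ p ∈ S, ∑ k : Fin 4, if twin p.1 p.2 k ∈ S then
      ψ (twin p.1 p.2 k) * (coeff c k * F (medialCornersAt p.1 p.2 k)) else 0 with hJ
  have hIJ : I = -J := sum_interior_weight_eq_neg_sum_twin_weight c S ψ F
  have hdiff : (∑ p ∈ S, ∑ k : Fin 4, if twin p.1 p.2 k ∈ S then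
      coeff c k * F (medialCornersAt p.1 p.2 k) * (ψ p - ψ (twin p.1 p.2 k)) else 0) = I - J := by
    rw [hI, hJ, ← Finset.sum_sub_distrib]
    refine Finset.sum_congr rfl fun p _ => ?_
    rw [← Finset.sum_sub_distrib]
    refine Finset.sum_congr rfl fun k _ => ?_
    split_ifs
    · ring
    · simp
  rw [hdiff, hIJ]
  ring

/-- Consistency with the barrier file: for the constant weight `ψ ≡ 1` the interior pairing vanishes
termwise and the weighted identity is `sum_halfCRForm_eq_halfCRFlux`. -/
theorem sum_weighted_halfCRForm_one (c : ℂ) (S : Finset (Site 2 × Fin 2)) (F : Site 2 × Site 2 → ℂ) :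
    ∑ p ∈ S, (fun _ => (1 : ℂ)) p * halfCRForm c p F = halfCRFlux c S F := by
  classical
  rw [sum_weighted_halfCRForm_eq]
  have h0 : (∑ p ∈ S, ∑ k : Fin 4, if twin p.1 p.2 k ∈ S then
      coeff c k * F (medialCornersAt p.1 p.2 k) * ((fun _ => (1 : ℂ)) p - (fun _ => (1 : ℂ)) (twin p.1 p.2 k))
      else 0) = 0 := by
    refine Finset.sum_eq_zero fun p _ => Finset.sum_eq_zero fun k _ => ?_
    split_ifs <;> simp
  rw [h0, mul_zero, zero_add, halfCRFlux]
  refine Finset.sum_congr rfl fun p _ => Finset.sum_congr rfl fun k _ => ?_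
  split_ifs <;> simp

/-- **The pairing form used by S5.** If `F` satisfies the vertex relation at every medial vertex of `S`
(`halfCRForm c p F = 0`, e.g. the corner observable off the boundary, by `HalfCRVertexRelation`), then the
interior `∂̄ψ`-pairing is exactly minus the `ψ`-weighted boundary flux:
`½ ∑_{interior} coeff c k · F · (ψ_p − ψ_twin) = −∑_{boundary} ψ_p · coeff c k · F`. -/
theorem weighted_pairing_eq_neg_flux_of_rel (c : ℂ) (S : Finset (Site 2 × Fin 2))
    (ψ : Site 2 × Fin 2 → ℂ) (F : Site 2 × Site 2 → ℂ) (hrel : ∀ p ∈ S, halfCRForm c p F = 0) :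
    (1 / 2 : ℂ) * (∑ p ∈ S, ∑ k : Fin 4, if twin p.1 p.2 k ∈ S then
        coeff c k * F (medialCornersAt p.1 p.2 k) * (ψ p - ψ (twin p.1 p.2 k)) else 0) =
      -∑ p ∈ S, ∑ k : Fin 4, if twin p.1 p.2 k ∈ S then 0 else
        ψ p * (coeff c k * F (medialCornersAt p.1 p.2 k)) := by
  classical
  have h := sum_weighted_halfCRForm_eq c S ψ F
  have h0 : ∑ p ∈ S, ψ p * halfCRForm c p F = 0 :=
    Finset.sum_eq_zero fun p hp => by rw [hrel p hp, mul_zero]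
  rw [h0] at h
  exact eq_neg_of_add_eq_zero_left h.symm

/-- The weighted identity with the weight supported INSIDE `S` kills the boundary flux: if `ψ` vanishes
at every medial vertex of `S` having a corner whose twin lies outside `S` (a discrete "compact support
in the interior"), then `∑_{p ∈ S} ψ_p · halfCRForm c p F` is the interior pairing alone. -/
theorem sum_weighted_halfCRForm_eq_interior_of_vanish (c : ℂ) (S : Finset (Site 2 × Fin 2))
    (ψ : Site 2 × Fin 2 → ℂ) (F : Site 2 × Site 2 → ℂ)
    (hψ : ∀ p ∈ S, ∀ k : Fin 4, twin p.1 p.2 k ∉ S → ψ p = 0) :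
    ∑ p ∈ S, ψ p * halfCRForm c p F =
      (1 / 2 : ℂ) * (∑ p ∈ S, ∑ k : Fin 4, if twin p.1 p.2 k ∈ S then
        coeff c k * F (medialCornersAt p.1 p.2 k) * (ψ p - ψ (twin p.1 p.2 k)) else 0) := by
  classical
  rw [sum_weighted_halfCRForm_eq]
  have h0 : (∑ p ∈ S, ∑ k : Fin 4, if twin p.1 p.2 k ∈ S then 0 else
      ψ p * (coeff c k * F (medialCornersAt p.1 p.2 k))) = 0 := by
    refine Finset.sum_eq_zero fun p hp => Finset.sum_eq_zero fun k _ => ?_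
    split_ifs with h
    · rfl
    · rw [hψ p hp k h, zero_mul]
  rw [h0, add_zero]

end Summit.CriticalPhenomena.CardyFormulaZ2.Cruxes.ParafermionToSLESixFamilies.IicTraceFluxPairing

end
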